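import Summits.CriticalPhenomena.SAWScalingLimit.Theorems.SAWDevelopingMapObservableToSLEHullApproxStep
import HarnessLib

/-!
# Crux `SAWDevelopingMap.ObservableToSLE` (stmt-CriticalPhenomena-10472), line
`floor-ratio-restriction-bootstrap`: swallowing finitely many disjoint smooth hulls (helper for STUB 4b)

Landing target:
`Summits/CriticalPhenomena/SAWScalingLimit/Theorems/SAWDevelopingMapObservableToSLEHullApproxMulti.lean`
(`--supports stmt-CriticalPhenomena-10472`).

Iterating the swallowing step `stub_hullApproxDomain_step`: for a chordal uniformizing map
`φ : (ℍ; 0, ∞) → (D; a, b)` and finitely many pairwise disjoint smooth hulls `J ∌ 0`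
(`IsArcHull`), the image `φ(ℍ ∖ ⋃ J)` is the carrier of a (Jordan) hull subdomain of `D`
(`stub_hullApproxDomain_multi`, registered sub-goal of STUB 4b `stub_hullApproxDomain`).
-/

noncomputable section

open Set Filter Topology Metric Function
open Literature.Probability.RandomPlanarGeometry
open UpperHalfPlane (upperHalfPlaneSet)

namespace Summit.CriticalPhenomena.SAWScalingLimit.Theorems.ObservableToSLE.FloorRatio

/-- **Swallowing finitely many disjoint smooth hulls.** For a chordal uniformizing map `φ` of
`(D; a, b)` and a finite set `S` of pairwise disjoint smooth hulls off `0`, `φ(ℍ ∖ ⋃₀ S)` is the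
carrier of a hull subdomain of `D` (induction on `S` with `stub_hullApproxDomain_step`:
Carathéodory's theorem, Pommerenke (1992) Thm. 2.6, and Newman's cross-cut theorem).
Registered sub-goal `stub_hullApproxDomain_multi` of STUB 4b (`stub_hullApproxDomain`).
[cite: PommerenkeBBCM1992, Thm. 2.6] -/
theorem stub_hullApproxDomain_multi :
    ∀ (D : DobrushinDomain) (φ : ConformalEquiv upperHalfPlaneSet D.carrier) (S : Finset (Set ℂ)),
      D.IsChordalUniformizing φ → (∀ J ∈ S, IsArcHull J ∧ (0 : ℂ) ∉ J) →
      (S : Set (Set ℂ)).Pairwise Disjoint →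
      ∃ D'' : DobrushinDomain, D.IsHullSubdomain D'' ∧
        D''.carrier = φ '' (upperHalfPlaneSet \ ⋃₀ (S : Set (Set ℂ))) := by
  intro D φ S hφ
  classical
  induction S using Finset.induction_on with
  | empty =>
    intro _ _
    refine ⟨D, MarkedDomain.isHullSubdomain_self D, ?_⟩
    rw [Finset.coe_empty, sUnion_empty, sdiff_empty, φ.bijOn.image_eq]
  | insert J S hJS ih =>
    intro hS hpair
    obtain ⟨D₁, hD₁, hcar⟩ := ih (fun J' hJ' ↦ hS J' (Finset.mem_insert_of_mem hJ'))
      (hpair.mono (by rw [Finset.coe_insert]; exact subset_insert _ _))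
    have hJ := hS J (Finset.mem_insert_self J S)
    have hdisj : Disjoint J (⋃₀ (S : Set (Set ℂ))) := by
      rw [disjoint_sUnion_right]
      intro J' hJ'
      have hne : J ≠ J' := fun h ↦ hJS (h ▸ (Finset.mem_coe.1 hJ'))
      exact hpair (by rw [Finset.coe_insert]; exact mem_insert _ _)
        (by rw [Finset.coe_insert]; exact mem_insert_of_mem _ hJ') hne
    obtain ⟨D₂, hD₂, hcar₂⟩ :=
      stub_hullApproxDomain_step D D₁ φ (⋃₀ (S : Set (Set ℂ))) J hφ hD₁ hcar hJ.1 hJ.2 hdisj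
    refine ⟨D₂, hD₂, ?_⟩
    rw [hcar₂, Finset.coe_insert, sUnion_insert, union_comm]

end Summit.CriticalPhenomena.SAWScalingLimit.Theorems.ObservableToSLE.FloorRatio

end
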